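import Summits.BirchSwinnertonDyer.Rank1Residual.X9.MainConjectureInstancesN3
import Summits.BirchSwinnertonDyer.Rank1Residual.X9.S4DescentChainOnlyPair
import Summits.BirchSwinnertonDyer.Rank1Residual.X9.S4DescentPairsZimmertA
import Summits.BirchSwinnertonDyer.Rank1Residual.X9.S4DescentPairsZimmertC
import Summits.BirchSwinnertonDyer.Rank1Residual.X9.ShapiroPairsSevenRankZero
import HarnessLib

/-!
# Class X9 (N3), rank `0`: Mazur's cyclotomic main conjecture INTEGRALLY WITH `μ = 0` — Greenberg's Conj. 1.11 — AT THE PAIR, for the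
# N3 residue cells that have a kernel `BSDp` theorem (part 4: `135252b1`, `259848d1`, `56316n1`, `407277i1` @ 7)

HONEST FRAMING (cell `b2b-bsdres-*`, verbatim): the cell deletes COMBINATION-SHAPED residual classes of
the rank-≤1 BSD formula from PUBLISHED theorems only and TYPES the construction-shaped remainder; this
is not "finishing BSD". Class X9 stays TYPED at class level: its typed input `IntegralMainConjectureOnClassX9`
(one integral cyclotomic main conjecture at a good ordinary `p ≥ 5` with `ρ̄_{E,p}` irreducible and NOT surjective
— exactly where Kato's Thm. 17.4 (3) and BCS 2025 Thm. 1.1.2 (b) have no antecedent, `ClassX9.not_bigIm`) stays OPEN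
as a ∀-statement. Everything here is PER PAIR; nothing is booked; no named fact. Unit `b2b-bsdres-x9`, gen 15
(class-closure N3 lead: this file is the E1 line 'typed target INHABITED at the pair' of `class-closure/N3/WEEK-2026-08-28.md`).

WHAT: gen 5's `mazurMainConjecture_with_mu_zero_of_bsdp` (`Rank1Residual/X9MuInvariant.lean`): at a good ordinary
irreducible `p ≥ 5` with `r_an(E) = 0`, BCS 2025 Thm. 1.1.2 (a) gives `char X(E/ℚ_∞) = (g)` with `ι g = p^k·L_p`;
`BSD(E,p)` (through Greenberg Thm. 4.1, the period unit, modularity, GZK) forces `k = 0`, and ONE unit coefficient of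
`ϖ·L_p(f_E, α)` (certificate `hcert`) gives `μ(g) = 0`: Mazur's main conjecture for `(E, p)` in `Λ`, with `μ = 0`, at
every cyclotomic datum. HERE it is instantiated at the N3 cells (`class-closure/N3/pairs.tsv`, all `r = 0`) whose
`BSD(E,p)` is ALREADY a kernel theorem of this lineage with only finite-certificate binders: the `5Ns` cells closed by
an EXACT Shapiro `5`-descent (`X9/ShapiroPairsCert*.lean`, gen 13), the `5S4` cells closed by a Zimmert-certified full
`5`-descent (`X9/S4DescentPairsZimmert*.lean`, `X9/S4DescentChainOnlyPair.lean`, gens 13–14) and the `7Ns` cell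
`407277i1` (`X9/ShapiroPairsSevenRankZero.lean`, gen 14). Per record: the pair's `bsdp_s<label>` theorem BY NAME + the
`IntModel` toolkit (good ORDINARY reduction at `p` by the kernel point count `#Ẽ(𝔽_p)`, `E[p]` irreducible by a
Frobenius witness `ℓ`, Mazur 1978 Prop. 6.3 (1)) + the certificate `hcert` (gen 9 `HOME/b2b-bsdres-x9/g9/mu/MU-ALL.tsv`:
`μ(𝓛_p(E)) = 0` on TWO engines for all 790 X9 pairs). Binders: PUBLISHED `hBCS`, `hGr`, `h5`, `hmodL`, `hGZK`; FINITE
`r_an = 0`, `#Ш_an = q` (`ord_p q = 0`), the descent line `hSel`, `hcert`; instance binders `[IsElliptic]`,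
`[IsGloballyMinimal]` dischargeable by Kraus' bounded criterion (as in `X9/TransportPairs*.lean`). So at each of these
pairs Greenberg's Conjecture 1.11 (`μ = 0` for `E[p]` irreducible) HOLDS — for a split-Cartan-normaliser or `𝔖₄`-exceptional
image — granted published theorems and finite two-engine certificates; the class-level statement is untouched.

References: Greenberg, LNM 1716 (1999) Conj. 1.11, Thm. 4.1; Burungale–Castella–Skinner IMRN 2025 Thm. 1.1.2 (a);
Greenberg–Vatsal 2000 §3 (period unit); Mazur 1978 Prop. 6.3 (1); Cremona's tables.
-/

set_option autoImplicit false

noncomputable section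

open scoped Classical MatrixGroups ModularForm

open CongruenceSubgroup WeierstrassCurve Literature.NumberTheory.EllipticCurves
  Literature.NumberTheory.EllipticCurves.ModularForms Literature.NumberTheory.EllipticCurves.Rank1Residual
  Literature.NumberTheory.EllipticCurves.Rank1Residual.Typed
  Literature.NumberTheory.EllipticCurves.Rank1Residual.X11RankOneCertificates
  Summit.BirchSwinnertonDyer.BirchSwinnertonDyer.Rank1Residual.IntModel
  Summit.BirchSwinnertonDyer.BirchSwinnertonDyer.Rank1Residual.X11RankOne
  Summit.BirchSwinnertonDyer.Rank1Residual.X11b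

namespace Summit.BirchSwinnertonDyer.Rank1Residual.X9
/-! ### Kernel data and records -/

/-- `#Ẽ(𝔽₅) = 9` (`a₅ = -3`: good ORDINARY) for Cremona's model `135252b1` (kernel count). [folklore] -/
theorem card_m135252b1_5 :
    Nat.card (((⟨0, 0, 0, 45951, 13750909⟩ : WeierstrassCurve ℤ).map
      (Int.castRingHom (ZMod 5))).toAffine.Point) = 9 := by
  rw [@WeierstrassCurve.natCard_point_eq_one_add_card (ZMod 5) (@ZMod.instField 5 ⟨by norm_num⟩) _ _ _
    (by decide +kernel), @card_sol_eq_sum_euler (ZMod 5) (@ZMod.instField 5 ⟨by norm_num⟩) _ _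
    (by rw [ZMod.ringChar_zmod_n]; decide), ZMod.card]
  decide +kernel

/-- `#Ẽ(𝔽₁₁) = 13` (`a₁₁ = -1`; root-free mod `5`) for Cremona's model `135252b1` (kernel count). [folklore] -/
theorem card_m135252b1_11 :
    Nat.card (((⟨0, 0, 0, 45951, 13750909⟩ : WeierstrassCurve ℤ).map
      (Int.castRingHom (ZMod 11))).toAffine.Point) = 13 := by
  rw [@WeierstrassCurve.natCard_point_eq_one_add_card (ZMod 11) (@ZMod.instField 11 ⟨by norm_num⟩) _ _ _
    (by decide +kernel), @card_sol_eq_sum_euler (ZMod 11) (@ZMod.instField 11 ⟨by norm_num⟩) _ _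
    (by rw [ZMod.ringChar_zmod_n]; decide), ZMod.card]
  decide +kernel

/-- **Mazur's main conjecture with `μ = 0` for `(135252b1, 5)`** (Cremona model `[0, 0, 0, 45951, 13750909]`; good ORDINARY at `5`, `a₅ = -3`,
`#Ẽ(𝔽₅) = 9`; `ρ̄_{E,5}` irreducible — Frobenius witness `ℓ = 11`: `#Ẽ(𝔽₁₁) = 13`, `a₁₁ = -1`, `X² − a₁₁X + 11` root-free
mod `5` — and, census datum, NOT surjective, of EXCEPTIONAL type `5S4` (Zimmert-certified full `5`-descent, gen 14); `r_an = 0`, `#Ш_an = 1`): the N3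
typed target INHABITED at this pair — from the kernel theorem `bsdp_s135252b1` (`X9/S4DescentPairsZimmertC.lean`, binders `hGZK`, `r_an ≤ 1`,
`#Ш_an` a `5`-adic unit, the descent line `hSel`) and the certificate `hcert` (`μ(𝓛₅(E)) = 0`, gen 9 `MU-ALL.tsv`, two engines).
Per pair; the class-level statement stays OPEN. [cite: GreenbergLNM1716, §1 Conj. 1.11 and Thm. 4.1 (p. 102)]
[cite: BurungaleCastellaSkinner2025, Thm. 1.1.2 (a) (p. 2 of arXiv:2405.00270v2)] [cite: Cremona2006, Table 1 (Cremona label 135252b1)] -/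
theorem mazurMainConjecture_s135252b1
    (hBCS : burungale_castella_skinner_charIdeal_eq_padicLFunction)
    (hGr : greenberg_charValue_rankZero) (h5 : realPeriodRat_eq_unit_mul_plusPeriod)
    (hmodL : hasEntireLFunction_rat) (hGZK : rank_eq_analyticRank_of_analyticRank_le_one)
    (W : WeierstrassCurve ℚ) [W.IsElliptic] [W.IsGloballyMinimal] [Fact (Nat.Prime 5)]
    (hW : W = ⟨0, 0, 0, 45951, 13750909⟩) (hr : W.analyticRank = 0)
    {q : ℚ} (hq : shaAn W = (q : ℂ)) (hv : padicValRat 5 q = 0)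
    (hSel : Nat.card (W.selmerGroup (5 : ℤ)) = 5 ^ W.analyticRank)
    (hcert : ∀ [NeZero (W.conductorNorm ℤ)] (f : CuspForm (Gamma0 (W.conductorNorm ℤ)) 2),
        IsNewformOf W f → ∀ (ϖ : ℚ), (ϖ : ℝ) * W.realPeriodRat = plusPeriod f →
      ∃ m : ℕ, ‖PowerSeries.coeff m
        (PowerSeries.C (ϖ : ℚ_[5]) * padicLFunction f (unitRoot W 5 : ℚ_[5]))‖ = 1) :
    ∀ (κ : ZpExtension ℚ 5) (γ : Field.absoluteGaloisGroup ℚ),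
        κ.IsCyclotomic → κ.IsTopGenerator γ → IsCyclotomicVariable 5 γ →
      ∀ [NeZero (W.conductorNorm ℤ)] (f : CuspForm (Gamma0 (W.conductorNorm ℤ)) 2),
        IsNewformOf W f → ∀ (ϖ : ℚ), (ϖ : ℝ) * W.realPeriodRat = plusPeriod f →
      ∀ (D : W.SelmerDualData κ γ), D.IsTorsion ∧
        ∃ g : IwasawaAlgebra 5, D.charIdeal = Ideal.span {g} ∧
          GreenbergVatsal2000.HasUnitContent g ∧
          iwasawaToPowerSeries 5 g =
            PowerSeries.C (ϖ : ℚ_[5]) * padicLFunction f (unitRoot W 5 : ℚ_[5]) := by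
  have hbsd : BSDp W 5 := bsdp_s135252b1 hGZK W hW (by rw [hr]; norm_num) hq hv hSel
  have hIW : integralModelInt W = ⟨0, 0, 0, 45951, 13750909⟩ :=
    integralModelInt_eq_of_map_eq _ (by rw [hW]; ext <;> simp [WeierstrassCurve.map])
  haveI : Fact (Nat.Prime 11) := ⟨by norm_num⟩
  exact mazurMainConjecture_of_ainvs_of_bsdp hBCS hGr h5 hmodL hGZK 0 0 0 45951 13750909 hIW 5 11 13 9 (by norm_num)
    (by decide +kernel) card_m135252b1_5 (by decide) (by decide) (by decide +kernel) card_m135252b1_11 (by decide)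
    hr hbsd hcert

/-- `#Ẽ(𝔽₅) = 5` (`a₅ = 1`: good ORDINARY) for Cremona's model `259848d1` (kernel count). [folklore] -/
theorem card_m259848d1_5 :
    Nat.card (((⟨0, 0, 0, -663867, 207521307⟩ : WeierstrassCurve ℤ).map
      (Int.castRingHom (ZMod 5))).toAffine.Point) = 5 := by
  rw [@WeierstrassCurve.natCard_point_eq_one_add_card (ZMod 5) (@ZMod.instField 5 ⟨by norm_num⟩) _ _ _
    (by decide +kernel), @card_sol_eq_sum_euler (ZMod 5) (@ZMod.instField 5 ⟨by norm_num⟩) _ _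
    (by rw [ZMod.ringChar_zmod_n]; decide), ZMod.card]
  decide +kernel

/-- `#Ẽ(𝔽₇) = 8` (`a₇ = 0`; root-free mod `5`) for Cremona's model `259848d1` (kernel count). [folklore] -/
theorem card_m259848d1_7 :
    Nat.card (((⟨0, 0, 0, -663867, 207521307⟩ : WeierstrassCurve ℤ).map
      (Int.castRingHom (ZMod 7))).toAffine.Point) = 8 := by
  rw [@WeierstrassCurve.natCard_point_eq_one_add_card (ZMod 7) (@ZMod.instField 7 ⟨by norm_num⟩) _ _ _
    (by decide +kernel), @card_sol_eq_sum_euler (ZMod 7) (@ZMod.instField 7 ⟨by norm_num⟩) _ _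
    (by rw [ZMod.ringChar_zmod_n]; decide), ZMod.card]
  decide +kernel

/-- **Mazur's main conjecture with `μ = 0` for `(259848d1, 5)`** (Cremona model `[0, 0, 0, -663867, 207521307]`; good ORDINARY at `5`, `a₅ = 1`,
`#Ẽ(𝔽₅) = 5`; `ρ̄_{E,5}` irreducible — Frobenius witness `ℓ = 7`: `#Ẽ(𝔽₇) = 8`, `a₇ = 0`, `X² − a₇X + 7` root-free
mod `5` — and, census datum, NOT surjective, of EXCEPTIONAL type `5S4` (Zimmert-certified full `5`-descent, gen 14); `r_an = 0`, `#Ш_an = 1`): the N3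
typed target INHABITED at this pair — from the kernel theorem `bsdp_s259848d1` (`X9/S4DescentPairsZimmertA.lean`, binders `hGZK`, `r_an ≤ 1`,
`#Ш_an` a `5`-adic unit, the descent line `hSel`) and the certificate `hcert` (`μ(𝓛₅(E)) = 0`, gen 9 `MU-ALL.tsv`, two engines).
Per pair; the class-level statement stays OPEN. [cite: GreenbergLNM1716, §1 Conj. 1.11 and Thm. 4.1 (p. 102)]
[cite: BurungaleCastellaSkinner2025, Thm. 1.1.2 (a) (p. 2 of arXiv:2405.00270v2)] [cite: Cremona2006, Table 1 (Cremona label 259848d1)] -/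
theorem mazurMainConjecture_s259848d1
    (hBCS : burungale_castella_skinner_charIdeal_eq_padicLFunction)
    (hGr : greenberg_charValue_rankZero) (h5 : realPeriodRat_eq_unit_mul_plusPeriod)
    (hmodL : hasEntireLFunction_rat) (hGZK : rank_eq_analyticRank_of_analyticRank_le_one)
    (W : WeierstrassCurve ℚ) [W.IsElliptic] [W.IsGloballyMinimal] [Fact (Nat.Prime 5)]
    (hW : W = ⟨0, 0, 0, -663867, 207521307⟩) (hr : W.analyticRank = 0)
    {q : ℚ} (hq : shaAn W = (q : ℂ)) (hv : padicValRat 5 q = 0)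
    (hSel : Nat.card (W.selmerGroup (5 : ℤ)) = 5 ^ W.analyticRank)
    (hcert : ∀ [NeZero (W.conductorNorm ℤ)] (f : CuspForm (Gamma0 (W.conductorNorm ℤ)) 2),
        IsNewformOf W f → ∀ (ϖ : ℚ), (ϖ : ℝ) * W.realPeriodRat = plusPeriod f →
      ∃ m : ℕ, ‖PowerSeries.coeff m
        (PowerSeries.C (ϖ : ℚ_[5]) * padicLFunction f (unitRoot W 5 : ℚ_[5]))‖ = 1) :
    ∀ (κ : ZpExtension ℚ 5) (γ : Field.absoluteGaloisGroup ℚ),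
        κ.IsCyclotomic → κ.IsTopGenerator γ → IsCyclotomicVariable 5 γ →
      ∀ [NeZero (W.conductorNorm ℤ)] (f : CuspForm (Gamma0 (W.conductorNorm ℤ)) 2),
        IsNewformOf W f → ∀ (ϖ : ℚ), (ϖ : ℝ) * W.realPeriodRat = plusPeriod f →
      ∀ (D : W.SelmerDualData κ γ), D.IsTorsion ∧
        ∃ g : IwasawaAlgebra 5, D.charIdeal = Ideal.span {g} ∧
          GreenbergVatsal2000.HasUnitContent g ∧
          iwasawaToPowerSeries 5 g =
            PowerSeries.C (ϖ : ℚ_[5]) * padicLFunction f (unitRoot W 5 : ℚ_[5]) := by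
  have hbsd : BSDp W 5 := bsdp_s259848d1 hGZK W hW (by rw [hr]; norm_num) hq hv hSel
  have hIW : integralModelInt W = ⟨0, 0, 0, -663867, 207521307⟩ :=
    integralModelInt_eq_of_map_eq _ (by rw [hW]; ext <;> simp [WeierstrassCurve.map])
  haveI : Fact (Nat.Prime 7) := ⟨by norm_num⟩
  exact mazurMainConjecture_of_ainvs_of_bsdp hBCS hGr h5 hmodL hGZK 0 0 0 (-663867) 207521307 hIW 5 7 8 5 (by norm_num)
    (by decide +kernel) card_m259848d1_5 (by decide) (by decide) (by decide +kernel) card_m259848d1_7 (by decide)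
    hr hbsd hcert

/-- `#Ẽ(𝔽₅) = 2` (`a₅ = 4`: good ORDINARY) for Cremona's model `56316n1` (kernel count). [folklore] -/
theorem card_m56316n1_5 :
    Nat.card (((⟨0, 1, 0, -7204236, 16612319412⟩ : WeierstrassCurve ℤ).map
      (Int.castRingHom (ZMod 5))).toAffine.Point) = 2 := by
  rw [@WeierstrassCurve.natCard_point_eq_one_add_card (ZMod 5) (@ZMod.instField 5 ⟨by norm_num⟩) _ _ _
    (by decide +kernel), @card_sol_eq_sum_euler (ZMod 5) (@ZMod.instField 5 ⟨by norm_num⟩) _ _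
    (by rw [ZMod.ringChar_zmod_n]; decide), ZMod.card]
  decide +kernel

/-- `#Ẽ(𝔽₇) = 8` (`a₇ = 0`; root-free mod `5`) for Cremona's model `56316n1` (kernel count). [folklore] -/
theorem card_m56316n1_7 :
    Nat.card (((⟨0, 1, 0, -7204236, 16612319412⟩ : WeierstrassCurve ℤ).map
      (Int.castRingHom (ZMod 7))).toAffine.Point) = 8 := by
  rw [@WeierstrassCurve.natCard_point_eq_one_add_card (ZMod 7) (@ZMod.instField 7 ⟨by norm_num⟩) _ _ _
    (by decide +kernel), @card_sol_eq_sum_euler (ZMod 7) (@ZMod.instField 7 ⟨by norm_num⟩) _ _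
    (by rw [ZMod.ringChar_zmod_n]; decide), ZMod.card]
  decide +kernel

/-- **Mazur's main conjecture with `μ = 0` for `(56316n1, 5)`** (Cremona model `[0, 1, 0, -7204236, 16612319412]`; good ORDINARY at `5`, `a₅ = 4`,
`#Ẽ(𝔽₅) = 2`; `ρ̄_{E,5}` irreducible — Frobenius witness `ℓ = 7`: `#Ẽ(𝔽₇) = 8`, `a₇ = 0`, `X² − a₇X + 7` root-free
mod `5` — and, census datum, NOT surjective, of EXCEPTIONAL type `5S4` (Zimmert-certified full `5`-descent, gen 13); `r_an = 0`, `#Ш_an = 1`): the N3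
typed target INHABITED at this pair — from the kernel theorem `bsdp_s56316n1` (`X9/S4DescentChainOnlyPair.lean`, binders `hGZK`, `r_an ≤ 1`,
`#Ш_an` a `5`-adic unit, the descent line `hSel`) and the certificate `hcert` (`μ(𝓛₅(E)) = 0`, gen 9 `MU-ALL.tsv`, two engines).
Per pair; the class-level statement stays OPEN. [cite: GreenbergLNM1716, §1 Conj. 1.11 and Thm. 4.1 (p. 102)]
[cite: BurungaleCastellaSkinner2025, Thm. 1.1.2 (a) (p. 2 of arXiv:2405.00270v2)] [cite: Cremona2006, Table 1 (Cremona label 56316n1)] -/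
theorem mazurMainConjecture_s56316n1
    (hBCS : burungale_castella_skinner_charIdeal_eq_padicLFunction)
    (hGr : greenberg_charValue_rankZero) (h5 : realPeriodRat_eq_unit_mul_plusPeriod)
    (hmodL : hasEntireLFunction_rat) (hGZK : rank_eq_analyticRank_of_analyticRank_le_one)
    (W : WeierstrassCurve ℚ) [W.IsElliptic] [W.IsGloballyMinimal] [Fact (Nat.Prime 5)]
    (hW : W = ⟨0, 1, 0, -7204236, 16612319412⟩) (hr : W.analyticRank = 0)
    {q : ℚ} (hq : shaAn W = (q : ℂ)) (hv : padicValRat 5 q = 0)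
    (hSel : Nat.card (W.selmerGroup (5 : ℤ)) = 5 ^ W.analyticRank)
    (hcert : ∀ [NeZero (W.conductorNorm ℤ)] (f : CuspForm (Gamma0 (W.conductorNorm ℤ)) 2),
        IsNewformOf W f → ∀ (ϖ : ℚ), (ϖ : ℝ) * W.realPeriodRat = plusPeriod f →
      ∃ m : ℕ, ‖PowerSeries.coeff m
        (PowerSeries.C (ϖ : ℚ_[5]) * padicLFunction f (unitRoot W 5 : ℚ_[5]))‖ = 1) :
    ∀ (κ : ZpExtension ℚ 5) (γ : Field.absoluteGaloisGroup ℚ),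
        κ.IsCyclotomic → κ.IsTopGenerator γ → IsCyclotomicVariable 5 γ →
      ∀ [NeZero (W.conductorNorm ℤ)] (f : CuspForm (Gamma0 (W.conductorNorm ℤ)) 2),
        IsNewformOf W f → ∀ (ϖ : ℚ), (ϖ : ℝ) * W.realPeriodRat = plusPeriod f →
      ∀ (D : W.SelmerDualData κ γ), D.IsTorsion ∧
        ∃ g : IwasawaAlgebra 5, D.charIdeal = Ideal.span {g} ∧
          GreenbergVatsal2000.HasUnitContent g ∧
          iwasawaToPowerSeries 5 g =
            PowerSeries.C (ϖ : ℚ_[5]) * padicLFunction f (unitRoot W 5 : ℚ_[5]) := by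
  have hbsd : BSDp W 5 := bsdp_s56316n1 hGZK W hW (by rw [hr]; norm_num) hq hv hSel
  have hIW : integralModelInt W = ⟨0, 1, 0, -7204236, 16612319412⟩ :=
    integralModelInt_eq_of_map_eq _ (by rw [hW]; ext <;> simp [WeierstrassCurve.map])
  haveI : Fact (Nat.Prime 7) := ⟨by norm_num⟩
  exact mazurMainConjecture_of_ainvs_of_bsdp hBCS hGr h5 hmodL hGZK 0 1 0 (-7204236) 16612319412 hIW 5 7 8 2 (by norm_num)
    (by decide +kernel) card_m56316n1_5 (by decide) (by decide) (by decide +kernel) card_m56316n1_7 (by decide)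
    hr hbsd hcert

/-- `#Ẽ(𝔽₇) = 10` (`a₇ = -2`: good ORDINARY) for Cremona's model `407277i1` (kernel count). [folklore] -/
theorem card_m407277i1_7 :
    Nat.card (((⟨0, 0, 1, -14458422, 21159548293⟩ : WeierstrassCurve ℤ).map
      (Int.castRingHom (ZMod 7))).toAffine.Point) = 10 := by
  rw [@WeierstrassCurve.natCard_point_eq_one_add_card (ZMod 7) (@ZMod.instField 7 ⟨by norm_num⟩) _ _ _
    (by decide +kernel), @card_sol_eq_sum_euler (ZMod 7) (@ZMod.instField 7 ⟨by norm_num⟩) _ _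
    (by rw [ZMod.ringChar_zmod_n]; decide), ZMod.card]
  decide +kernel

/-- `#Ẽ(𝔽₁₁) = 12` (`a₁₁ = 0`; root-free mod `7`) for Cremona's model `407277i1` (kernel count). [folklore] -/
theorem card_m407277i1_11 :
    Nat.card (((⟨0, 0, 1, -14458422, 21159548293⟩ : WeierstrassCurve ℤ).map
      (Int.castRingHom (ZMod 11))).toAffine.Point) = 12 := by
  rw [@WeierstrassCurve.natCard_point_eq_one_add_card (ZMod 11) (@ZMod.instField 11 ⟨by norm_num⟩) _ _ _
    (by decide +kernel), @card_sol_eq_sum_euler (ZMod 11) (@ZMod.instField 11 ⟨by norm_num⟩) _ _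
    (by rw [ZMod.ringChar_zmod_n]; decide), ZMod.card]
  decide +kernel

/-- **Mazur's main conjecture with `μ = 0` for `(407277i1, 7)`** (Cremona model `[0, 0, 1, -14458422, 21159548293]`; good ORDINARY at `7`, `a₇ = -2`,
`#Ẽ(𝔽₇) = 10`; `ρ̄_{E,7}` irreducible — Frobenius witness `ℓ = 11`: `#Ẽ(𝔽₁₁) = 12`, `a₁₁ = 0`, `X² − a₁₁X + 11` root-free
mod `7` — and, census datum, NOT surjective, of split-Cartan-normaliser type `7Ns` (EXACT Shapiro `7`-descent, gen 14); `r_an = 0`, `#Ш_an = 1`): the N3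
typed target INHABITED at this pair — from the kernel theorem `bsdp_s407277i1` (`X9/ShapiroPairsSevenRankZero.lean`, binders `hGZK`, `r_an ≤ 1`,
`#Ш_an` a `7`-adic unit, the descent line `hSel`) and the certificate `hcert` (`μ(𝓛₇(E)) = 0`, gen 9 `MU-ALL.tsv`, two engines).
Per pair; the class-level statement stays OPEN. [cite: GreenbergLNM1716, §1 Conj. 1.11 and Thm. 4.1 (p. 102)]
[cite: BurungaleCastellaSkinner2025, Thm. 1.1.2 (a) (p. 2 of arXiv:2405.00270v2)] [cite: Cremona2006, Table 1 (Cremona label 407277i1)] -/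
theorem mazurMainConjecture_s407277i1
    (hBCS : burungale_castella_skinner_charIdeal_eq_padicLFunction)
    (hGr : greenberg_charValue_rankZero) (h5 : realPeriodRat_eq_unit_mul_plusPeriod)
    (hmodL : hasEntireLFunction_rat) (hGZK : rank_eq_analyticRank_of_analyticRank_le_one)
    (W : WeierstrassCurve ℚ) [W.IsElliptic] [W.IsGloballyMinimal] [Fact (Nat.Prime 7)]
    (hW : W = ⟨0, 0, 1, -14458422, 21159548293⟩) (hr : W.analyticRank = 0)
    {q : ℚ} (hq : shaAn W = (q : ℂ)) (hv : padicValRat 7 q = 0)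
    (hSel : Nat.card (W.selmerGroup (7 : ℤ)) = 7 ^ W.analyticRank)
    (hcert : ∀ [NeZero (W.conductorNorm ℤ)] (f : CuspForm (Gamma0 (W.conductorNorm ℤ)) 2),
        IsNewformOf W f → ∀ (ϖ : ℚ), (ϖ : ℝ) * W.realPeriodRat = plusPeriod f →
      ∃ m : ℕ, ‖PowerSeries.coeff m
        (PowerSeries.C (ϖ : ℚ_[7]) * padicLFunction f (unitRoot W 7 : ℚ_[7]))‖ = 1) :
    ∀ (κ : ZpExtension ℚ 7) (γ : Field.absoluteGaloisGroup ℚ),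
        κ.IsCyclotomic → κ.IsTopGenerator γ → IsCyclotomicVariable 7 γ →
      ∀ [NeZero (W.conductorNorm ℤ)] (f : CuspForm (Gamma0 (W.conductorNorm ℤ)) 2),
        IsNewformOf W f → ∀ (ϖ : ℚ), (ϖ : ℝ) * W.realPeriodRat = plusPeriod f →
      ∀ (D : W.SelmerDualData κ γ), D.IsTorsion ∧
        ∃ g : IwasawaAlgebra 7, D.charIdeal = Ideal.span {g} ∧
          GreenbergVatsal2000.HasUnitContent g ∧
          iwasawaToPowerSeries 7 g =
            PowerSeries.C (ϖ : ℚ_[7]) * padicLFunction f (unitRoot W 7 : ℚ_[7]) := by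
  have hbsd : BSDp W 7 := bsdp_s407277i1 hGZK W hW (by rw [hr]; norm_num) hq hv hSel
  have hIW : integralModelInt W = ⟨0, 0, 1, -14458422, 21159548293⟩ :=
    integralModelInt_eq_of_map_eq _ (by rw [hW]; ext <;> simp [WeierstrassCurve.map])
  haveI : Fact (Nat.Prime 11) := ⟨by norm_num⟩
  exact mazurMainConjecture_of_ainvs_of_bsdp hBCS hGr h5 hmodL hGZK 0 0 1 (-14458422) 21159548293 hIW 7 11 12 10 (by norm_num)
    (by decide +kernel) card_m407277i1_7 (by decide) (by decide) (by decide +kernel) card_m407277i1_11 (by decide)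
    hr hbsd hcert

end Summit.BirchSwinnertonDyer.Rank1Residual.X9

end
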